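import Summits.QuantumFields.BalabanUV.Beta.GAN24.TaylorMassLam
import Literature.MathematicalPhysics.QuantumFieldTheory.Balaban1983to89.Beta.AveragingHessianKernelsRooted

/-!
# `BalabanUV.Beta.GAN24.TaylorMassLamAt` — binder row G-an2-4 / (CONV-C), road S3 AT THE IN-BLOCK ROOT: package (ρ-a) of the row owner gan24-p1-g21's WANTED «ROOTED-S3-Λ»
# ([GAN24P1-G21-ONLINE] (W5)) — **`TaylorMassLam` §4–§5 RE-RUN FOR an1's ROOTED TABLE `hessFFAt (toSite r) Lc`** (box root `r ∈ box (d+1) Lc`): support, entry bound,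
# pointwise size and support of the lift, and the level-free ℓ¹ mass — SAME constants as the base module (`§1–§3` and `massLam_le` are root-free — BY NAME)

NOT IN PRINT; OUR BOOKKEEPING (G-an2-4 formalisation swarm → CRUX TEAM (2), leaf prover `b2b-balaban-gan24-formalise-leaf-01`, gen 60; METHOD = the owner's gen-6 `mkroot.py`
rule: same theorem names with `hessFF ↦ hessFFAt` in the `…At` namespace, an1's rooted support ∕ entry lemmas `hessKerAt_eq_zero_left ∕ _right` (box root, one extra binder
`(hr : r ∈ box (d+1) Lc)`), `abs_hessKerAt_le`, `hessFFAt_inl_inl ∕ _inl_inr ∕ _inr`; the root-free §1–§3 (`abs_avgLift_inl_inl_le`, `exists_of_avgLift_ne_zero`, `l1_sub_le_of_near`,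
`sum_abs_le_of_support`) BY NAME from `TaylorMassLam`; base module untouched).  [folklore]; 0 `def`, 0 cited facts, 0 `def … : Prop`, 0 sorry; NO estimate of Bałaban's.
HONEST FRAMING (cell contract, verbatim): «discharging `BetaPertH` makes Bałaban's UV stability UNCONDITIONAL — a real constructive-QFT result; it is NOT the continuum limit and
NOT the Clay problem.»  HONEST DEPENDENCY (verbatim): «continuum YM on T⁴ ⇐ BetaPertH ∧ nine spine estimates (0/9 proved); BetaPertH ⇐ (D1) ∧ (D4) ∧ CAP+tail; G-an2-4
gates asym, D1 and NE2/3/4.»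

## What (generic `d`; box root `ρ = toSite r`, `r ∈ box (d+1) Lc`, `1 ≤ Lc`; `ℓ = ell (d+1) Lc`)
* §4-ρ **`hessFFAt_ne_zero`** (a nonzero entry of `hessFFAt (toSite r) Lc μ y` is field–field with both sites in `Near Lc y`) (the entry bound `≤ 2ℓ²` is an1's
  `abs_hessKerAt_le` ∕ the owner's `BornLambdaLift.abs_hessFFAt_le` — used inline, not restated),
  **`abs_avgLift_hessFFAt_le`** (`|avgLift M (hessFFAt (toSite r) Lc μ y) x w a b| ≤ 2ℓ² ∕ M^{2(d+1)}`), **`avgLift_hessFFAt_ne_zero`** (both fine legs within `ℓ¹`-distance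
  `2(d+1)(Lc+1)·M` of `(M·Lc)•y`).
* §5-ρ **`sum_abs_avgLift_hessFFAt_le`** (`Σ_x Σ_w |avgLift M (hessFFAt (toSite r) Lc μ y) x w a b| ≤ (2R+1)^{2(d+1)}·2ℓ² ∕ M^{2(d+1)}`, `R = 2(d+1)(Lc+1)M`; with the base's
  root-free `massLam_le` a constant of `(d, Lc)` alone).
* bridge `abs_avgLift_hessFFAt_le_zero_root` (at `r = 0`: `toSite 0 = 0`, `hessFFAt_zero` — the base statement).
USE: (ρ-c) `TaylorRowLamInnerAt ∕ TableAt ∕ At` and (ρ-d) read these where the base rows read `TaylorMassLam` §4–§5.  Discharges NOTHING of (hS, hSall); NEVER «G-an2-4 closed»;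
NOT D1, NOT BetaPertH, NOT continuum, NOT Clay.
-/

noncomputable section

open Finset
open scoped BigOperators
open Literature.MathematicalPhysics.QuantumFieldTheory
open Literature.MathematicalPhysics.QuantumFieldTheory.Balaban1983to89
open Literature.MathematicalPhysics.QuantumFieldTheory.Balaban1983to89.Beta
open B12Sec2to5 (l1 l1_nonneg)
open ExpKernelCalculus (MKer l1_natSmul l1_sub_triangle)
open OneStepResolventKernel (Fib)
open InterLevelTransport (avgLift)
open AffineAveraging (box toSite)
open AveragingHessianKernels (hessFF Near ell near_self l1_le_of_near)
open AveragingHessianKernelsRooted (hessFFAt hessKerAt hessKerAt_eq_zero_left hessKerAt_eq_zero_right abs_hessKerAt_le hessFFAt_inl_inl hessFFAt_inl_inr hessFFAt_inr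
  hessFFAt_zero)
open Summit.QuantumFields.BalabanUV.Beta.GAN24.TaylorMassLam (abs_avgLift_inl_inl_le exists_of_avgLift_ne_zero l1_sub_le_of_near sum_abs_le_of_support
  abs_avgLift_hessFF_le)

namespace Summit.QuantumFields.BalabanUV.Beta.GAN24.TaylorMassLamAt

variable {d : ℕ}

/-! ## §4-ρ an1's ROOTED constraint Hessian and its lift: support and size -/

section Hessian

variable {Lc : ℕ} {r : Fin (d + 1) → ℕ}

/-- [folklore] SUPPORT OF an1's ROOTED CONSTRAINT HESSIAN (box root): a nonzero entry of `hessFFAt (toSite r) Lc μ y` is a field–field entry with both sites in the `Near` box. -/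
theorem hessFFAt_ne_zero (hr : r ∈ box (d + 1) Lc) {μ : Fin (d + 1)} {y X W : Fin (d + 1) → ℤ} {a b : Fib d} (h : hessFFAt (toSite r) Lc μ y X W a b ≠ 0) :
    (∃ α α' : Fin (d + 1), a = Sum.inl α ∧ b = Sum.inl α') ∧ Near Lc y X ∧ Near Lc y W := by
  rcases a with α | ν
  · rcases b with α' | ν'
    · rw [hessFFAt_inl_inl] at h
      refine ⟨⟨α, α', rfl, rfl⟩, ?_, ?_⟩
      · by_contra hX; exact h (hessKerAt_eq_zero_left hr (f := (α, X)) hX _)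
      · by_contra hW; exact h (hessKerAt_eq_zero_right hr _ (f' := (α', W)) hW)
    · exact absurd (hessFFAt_inl_inr (toSite r) Lc μ y X W α ν') h
  · exact absurd (hessFFAt_inr (toSite r) Lc μ y X W ν b) h

/-- [folklore] **L2-ρ, SIZE — THE LIFTED ROOTED CONSTRAINT HESSIAN IS `O(M^{−2(d+1)})` POINTWISE** (box root): `|avgLift M (hessFFAt (toSite r) Lc μ y) x w a b| ≤ 2ℓ² ∕ M^{2(d+1)}`. -/
theorem abs_avgLift_hessFFAt_le (M : ℕ) [NeZero M] (hL : 1 ≤ Lc) (hr : r ∈ box (d + 1) Lc) (μ : Fin (d + 1)) (y x w : Fin (d + 1) → ℤ) (a b : Fib d) :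
    |avgLift M (hessFFAt (toSite r) Lc μ y) x w a b| ≤ 2 * (ell (d + 1) Lc : ℝ) ^ 2 / (M : ℝ) ^ (2 * (d + 1)) := by
  have h0 : (0 : ℝ) ≤ 2 * (ell (d + 1) Lc : ℝ) ^ 2 / (M : ℝ) ^ (2 * (d + 1)) := by positivity
  rcases a with α | ν
  · rcases b with α' | ν'
    · exact abs_avgLift_inl_inl_le M (hessFFAt (toSite r) Lc μ y) α α'
        (fun X W => by rw [hessFFAt_inl_inl]; exact abs_hessKerAt_le hL μ y hr _ _) x w
    · -- the (inl, inr) block of `hessFFAt` vanishes identically, hence so does its lift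
      have hz : avgLift M (hessFFAt (toSite r) Lc μ y) x w (Sum.inl α) (Sum.inr ν') = 0 := by
        by_contra hne
        obtain ⟨X, W, hG, -, -⟩ := exists_of_avgLift_ne_zero M (hessFFAt (toSite r) Lc μ y) hne
        exact hG (hessFFAt_inl_inr (toSite r) Lc μ y X W α ν')
      rw [hz, abs_zero]; exact h0
  · have hz : avgLift M (hessFFAt (toSite r) Lc μ y) x w (Sum.inr ν) b = 0 := by
      by_contra hne
      obtain ⟨X, W, hG, -, -⟩ := exists_of_avgLift_ne_zero M (hessFFAt (toSite r) Lc μ y) hne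
      exact hG (hessFFAt_inr (toSite r) Lc μ y X W ν b)
    rw [hz, abs_zero]; exact h0

/-- [folklore] **L2-ρ, SUPPORT** (box root): a nonzero entry of `avgLift M (hessFFAt (toSite r) Lc μ y)` has both fine legs within `ℓ¹`-distance `2(d+1)(Lc+1)·M` of the
fine image `(M·Lc)•y` of its coarse bond. -/
theorem avgLift_hessFFAt_ne_zero (M : ℕ) [NeZero M] (hL : 1 ≤ Lc) (hr : r ∈ box (d + 1) Lc) {μ : Fin (d + 1)} {y x w : Fin (d + 1) → ℤ} {a b : Fib d}
    (h : avgLift M (hessFFAt (toSite r) Lc μ y) x w a b ≠ 0) :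
    l1 (x - ((M * Lc : ℕ) : ℤ) • y) ≤ 2 * ((d : ℝ) + 1) * (Lc + 1) * M ∧ l1 (w - ((M * Lc : ℕ) : ℤ) • y) ≤ 2 * ((d : ℝ) + 1) * (Lc + 1) * M := by
  obtain ⟨X, W, hG, hx, hw⟩ := exists_of_avgLift_ne_zero M (hessFFAt (toSite r) Lc μ y) h
  obtain ⟨-, hX, hW⟩ := hessFFAt_ne_zero hr hG
  have hM : (0 : ℝ) ≤ M := Nat.cast_nonneg M
  have key : ∀ {v V : Fin (d + 1) → ℤ}, l1 (v - (M : ℤ) • V) ≤ 2 * (d + 1) * M → Near Lc y V →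
      l1 (v - ((M * Lc : ℕ) : ℤ) • y) ≤ 2 * ((d : ℝ) + 1) * (Lc + 1) * M := by
    intro v V hv hV
    have h1 : l1 ((M : ℤ) • V - ((M * Lc : ℕ) : ℤ) • y) = (M : ℝ) * l1 (V - (Lc : ℤ) • y) := by
      rw [← l1_natSmul, smul_sub, smul_smul]; push_cast; rfl
    have h2 := l1_sub_le_of_near hL hV
    have tri := l1_sub_triangle v ((M : ℤ) • V) (((M * Lc : ℕ) : ℤ) • y)
    rw [h1] at tri
    have h3 : (M : ℝ) * l1 (V - (Lc : ℤ) • y) ≤ (M : ℝ) * (2 * ((d : ℝ) + 1) * Lc) := mul_le_mul_of_nonneg_left h2 hM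
    have h4 : (2 : ℝ) * (d + 1) * M + M * (2 * ((d : ℝ) + 1) * Lc) = 2 * ((d : ℝ) + 1) * (Lc + 1) * M := by ring
    linarith
  exact ⟨key hx hX, key hw hW⟩

/-- [folklore] BRIDGE: at the corner root `r = 0` (`toSite 0 = 0`, `hessFFAt_zero`) the rooted size bound is the base `abs_avgLift_hessFF_le`'s statement. -/
theorem abs_avgLift_hessFFAt_le_zero_root (M : ℕ) [NeZero M] (hL : 1 ≤ Lc) (μ : Fin (d + 1)) (y x w : Fin (d + 1) → ℤ) (a b : Fib d) :
    |avgLift M (hessFFAt 0 Lc μ y) x w a b| ≤ 2 * (ell (d + 1) Lc : ℝ) ^ 2 / (M : ℝ) ^ (2 * (d + 1)) := by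
  rw [hessFFAt_zero]
  exact abs_avgLift_hessFF_le M hL μ y x w a b

end Hessian

/-! ## §5-ρ The level-free ℓ¹ mass of the lifted rooted Hessian -/

section Mass

variable {Lc : ℕ} {r : Fin (d + 1) → ℕ}

/-- [folklore] **L2-ρ, MASS** (box root): over any finite sets of fine points `Σ_x Σ_w |avgLift M (hessFFAt (toSite r) Lc μ y) x w a b| ≤ (2R+1)^{2(d+1)}·2ℓ² ∕ M^{2(d+1)}`,
`R = 2(d+1)(Lc+1)M`; with the base's `massLam_le` this is `≤ (4(d+1)(Lc+1)+1)^{2(d+1)}·2ℓ²`, a constant of `(d, Lc)` alone — the SAME as the base module's. -/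
theorem sum_abs_avgLift_hessFFAt_le (M : ℕ) [NeZero M] (hL : 1 ≤ Lc) (hr : r ∈ box (d + 1) Lc) (μ : Fin (d + 1)) (y : Fin (d + 1) → ℤ) (a b : Fib d)
    (S T : Finset (Fin (d + 1) → ℤ)) :
    ∑ x ∈ S, ∑ w ∈ T, |avgLift M (hessFFAt (toSite r) Lc μ y) x w a b| ≤
      ((2 * (2 * (d + 1) * (Lc + 1) * M) + 1) ^ (d + 1) : ℕ) * ((2 * (2 * (d + 1) * (Lc + 1) * M) + 1) ^ (d + 1) : ℕ) *
        (2 * (ell (d + 1) Lc : ℝ) ^ 2 / (M : ℝ) ^ (2 * (d + 1))) := by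
  refine sum_abs_le_of_support (fun x w => avgLift M (hessFFAt (toSite r) Lc μ y) x w a b) (((M * Lc : ℕ) : ℤ) • y) (2 * (d + 1) * (Lc + 1) * M)
    (by positivity) (fun x w hne => ?_) (fun x w => abs_avgLift_hessFFAt_le M hL hr μ y x w a b)
  have h := avgLift_hessFFAt_ne_zero M hL hr hne
  have e : ((2 * (d + 1) * (Lc + 1) * M : ℕ) : ℝ) = 2 * ((d : ℝ) + 1) * (Lc + 1) * M := by push_cast; ring
  rw [e]
  exact h

end Mass

end Summit.QuantumFields.BalabanUV.Beta.GAN24.TaylorMassLamAt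

end
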